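import Summits.HodgeConjecture.HodgeConjecture.Theorems.HodgeLocusCensusPlaneSumCert
import HarnessLib

/-!
# HodgeLocusCensusPlaneSumStackCert — two-layer ("stacked") core certificates for the rank of [M_{δ₁} ; M_{δ₂}] (cell pub-hlocus, LEAD gen 5, (T37))
HONEST FRAMING: certified instances and evidence bearing on the general Hodge conjecture; no claim.

The census records, besides single-class ranks, STACKED ranks rank [M_Z ; M_{Π′}] (= codim of T_Z ∩ T_{Π′}; `GrSection.stackRank_{4,6,8}_4`,
17 / 54 / 120) and rank [M_Z ; M_{Z′}] (`TwistCells.stackRankZZprime_{4,6,8}_4`, 15 / 44 / 96). By the plane-sum entry formula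
(`HodgeLocusCensusPlaneSumCert`: entry (i,j) of M_δ = [pair sums of i+j all 2] · ζ^{tails} · C_δ(heads of i+j)), the stacked matrix of two
signed plane sums δ₁ = `planeList_n L1`, δ₂ = `planeList_n L2` is again block diagonal in the type, and its block of type k is the STACKED CORE BLOCK
[C¹_{shape k} ; C²_{shape k}] with rows (layer, head h ≤ s) and columns (head g ≤ 2 − s): rank [M_{δ₁} ; M_{δ₂}] = Σ_types rank [C¹_s ; C²_s].
A `StackCert` is the two-layer analogue of `CoreCert`: per shape an integral LU certificate of the stacked core block (pivot rows now carry a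
layer index), with the Boolean `StackCert.valid L1 L2` ((F) factorisation on both layers, (T) triangularity, (P) pivots) decided by the kernel in
the class file and turned into a rank theorem by `HodgeLocusCensusPlaneSumStackRank{4,6,8}`.
-/

namespace Summit.HodgeConjecture.HodgeConjecture.HodgeLocus.Census.PlaneSum

/-- the layer selector: layer 0 is the top class L1, any other layer index the bottom class L2. -/
def layer (L1 L2 : List (ℤ × ℕ × ℕ × ℕ)) (lay : ℕ) : List (ℤ × ℕ × ℕ × ℕ) := if lay = 0 then L1 else L2

/-- layer 0. -/
theorem layer_zero (L1 L2 : List (ℤ × ℕ × ℕ × ℕ)) : layer L1 L2 0 = L1 := rfl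
/-- layer 1. -/
theorem layer_one (L1 L2 : List (ℤ × ℕ × ℕ × ℕ)) : layer L1 L2 1 = L2 := rfl

/-- per shape s ∈ {0,1,2}³ (position 9s₀+3s₁+s₂): the rank r_s of the stacked core block [C¹_s ; C²_s], r_s ordered pivot rows (layer, h) and
columns g, the factor A_s (rows (layer, h) layer-major then lexicographic, r_s columns), the factor B_s (r_s rows, columns g lexicographic) and the
norm cofactors of the B-pivots — all in ℤ[ζ₈]. -/
structure StackCert where
  rsh : List ℕ
  pr : List (List (ℕ × ℕ × ℕ × ℕ))
  pc : List (List (ℕ × ℕ × ℕ))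
  tA : List (List (List Z8))
  tB : List (List (List Z8))
  tw : List (List Z8)

namespace StackCert

variable (Ψ : StackCert)

/-- rank of the stacked block of the shape. -/
def rs (s0 s1 s2 : ℕ) : ℕ := lget 0 Ψ.rsh (9 * s0 + 3 * s1 + s2)
/-- the ℓ-th pivot row (layer, head triple h ≤ s) … -/
def rowP (s0 s1 s2 ℓ : ℕ) : ℕ × ℕ × ℕ × ℕ := lget (0, 0, 0, 0) (lget [] Ψ.pr (9 * s0 + 3 * s1 + s2)) ℓ
/-- … and pivot column (a head triple g ≤ 2 − s). -/
def colP (s0 s1 s2 ℓ : ℕ) : ℕ × ℕ × ℕ := lget (0, 0, 0) (lget [] Ψ.pc (9 * s0 + 3 * s1 + s2)) ℓ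
/-- A_s[(layer, a, b, e), ℓ]. -/
def A (s0 s1 s2 lay a b e ℓ : ℕ) : Z8 :=
  lget 0 (lget [] (lget [] Ψ.tA (9 * s0 + 3 * s1 + s2)) (lay * ((s0 + 1) * ((s1 + 1) * (s2 + 1))) + a * ((s1 + 1) * (s2 + 1)) + b * (s2 + 1) + e)) ℓ
/-- B_s[ℓ, (a,b,e)]. -/
def B (s0 s1 s2 ℓ a b e : ℕ) : Z8 := lget 0 (lget [] (lget [] Ψ.tB (9 * s0 + 3 * s1 + s2)) ℓ) (a * ((3 - s1) * (3 - s2)) + b * (3 - s2) + e)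
/-- the norm cofactor of the ℓ-th B-pivot. -/
def w (s0 s1 s2 ℓ : ℕ) : Z8 := lget 0 (lget [] Ψ.tw (9 * s0 + 3 * s1 + s2)) ℓ

/-- (F) factorisation Σ_{ℓ<r_s} A_s[(layer, h), ℓ] B_s[ℓ, g] = C^{layer}(h+g) on every shape, both layers and every head pair. -/
def validF (L1 L2 : List (ℤ × ℕ × ℕ × ℕ)) : Bool :=
  Z8.allLT 3 fun s0 => Z8.allLT 3 fun s1 => Z8.allLT 3 fun s2 => Z8.allLT 2 fun lay =>
    Z8.allLT (s0 + 1) fun a => Z8.allLT (s1 + 1) fun b => Z8.allLT (s2 + 1) fun e =>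
      Z8.allLT (3 - s0) fun a' => Z8.allLT (3 - s1) fun b' => Z8.allLT (3 - s2) fun e' =>
        decide (Z8.rsum (Ψ.rs s0 s1 s2) (fun ℓ => Ψ.A s0 s1 s2 lay a b e ℓ * Ψ.B s0 s1 s2 ℓ a' b' e') =
          core (layer L1 L2 lay) (a + a') (b + b') (e + e'))
/-- (T) triangularity on the pivots: A_s[row_{ℓ₀}, ℓ] = 0 and B_s[ℓ, col_{ℓ₀}] = 0 for ℓ₀ < ℓ. -/
def validT : Bool :=
  Z8.allLT 3 fun s0 => Z8.allLT 3 fun s1 => Z8.allLT 3 fun s2 =>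
    Z8.allLT (Ψ.rs s0 s1 s2) fun ℓ₀ => Z8.allLT (Ψ.rs s0 s1 s2) fun ℓ => decide (ℓ ≤ ℓ₀) ||
      (decide (Ψ.A s0 s1 s2 (Ψ.rowP s0 s1 s2 ℓ₀).1 (Ψ.rowP s0 s1 s2 ℓ₀).2.1 (Ψ.rowP s0 s1 s2 ℓ₀).2.2.1 (Ψ.rowP s0 s1 s2 ℓ₀).2.2.2 ℓ = 0) &&
       decide (Ψ.B s0 s1 s2 ℓ (Ψ.colP s0 s1 s2 ℓ₀).1 (Ψ.colP s0 s1 s2 ℓ₀).2.1 (Ψ.colP s0 s1 s2 ℓ₀).2.2 = 0))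
/-- (P) pivots: A_s[row_ℓ, ℓ] is a positive integer, B_s[ℓ, col_ℓ] · w_ℓ is a positive integer, the pivots lie in their layers and boxes. -/
def validP : Bool :=
  Z8.allLT 3 fun s0 => Z8.allLT 3 fun s1 => Z8.allLT 3 fun s2 => Z8.allLT (Ψ.rs s0 s1 s2) fun ℓ =>
    (Ψ.A s0 s1 s2 (Ψ.rowP s0 s1 s2 ℓ).1 (Ψ.rowP s0 s1 s2 ℓ).2.1 (Ψ.rowP s0 s1 s2 ℓ).2.2.1 (Ψ.rowP s0 s1 s2 ℓ).2.2.2 ℓ).isPosConst &&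
    (Ψ.B s0 s1 s2 ℓ (Ψ.colP s0 s1 s2 ℓ).1 (Ψ.colP s0 s1 s2 ℓ).2.1 (Ψ.colP s0 s1 s2 ℓ).2.2 * Ψ.w s0 s1 s2 ℓ).isPosConst &&
    decide ((Ψ.rowP s0 s1 s2 ℓ).1 ≤ 1 ∧ (Ψ.rowP s0 s1 s2 ℓ).2.1 ≤ s0 ∧ (Ψ.rowP s0 s1 s2 ℓ).2.2.1 ≤ s1 ∧ (Ψ.rowP s0 s1 s2 ℓ).2.2.2 ≤ s2 ∧
      (Ψ.colP s0 s1 s2 ℓ).1 ≤ 2 - s0 ∧ (Ψ.colP s0 s1 s2 ℓ).2.1 ≤ 2 - s1 ∧ (Ψ.colP s0 s1 s2 ℓ).2.2 ≤ 2 - s2)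
/-- VALIDITY of a stacked certificate for the pair of classes (L1 ; L2). -/
def valid (L1 L2 : List (ℤ × ℕ × ℕ × ℕ)) : Bool := Ψ.validF L1 L2 && Ψ.validT && Ψ.validP

variable {Ψ} {L1 L2 : List (ℤ × ℕ × ℕ × ℕ)}

/-- soundness of (F). -/
theorem factor_eq (h : Ψ.valid L1 L2 = true) {s0 s1 s2 lay a b e a' b' e' : ℕ} (h0 : s0 < 3) (h1 : s1 < 3) (h2 : s2 < 3) (hl : lay < 2)
    (ha : a < s0 + 1) (hb : b < s1 + 1) (he : e < s2 + 1) (ha' : a' < 3 - s0) (hb' : b' < 3 - s1) (he' : e' < 3 - s2) :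
    Z8.rsum (Ψ.rs s0 s1 s2) (fun ℓ => Ψ.A s0 s1 s2 lay a b e ℓ * Ψ.B s0 s1 s2 ℓ a' b' e') = core (layer L1 L2 lay) (a + a') (b + b') (e + e') := by
  have hF : Ψ.validF L1 L2 = true := by
    rw [valid, Bool.and_eq_true, Bool.and_eq_true] at h
    exact h.1.1
  simp only [validF, Z8.allLT_iff, decide_eq_true_eq] at hF
  exact hF s0 h0 s1 h1 s2 h2 lay hl a ha b hb e he a' ha' b' hb' e' he'

/-- soundness of (T), A part. -/
theorem A_upper_zero (h : Ψ.valid L1 L2 = true) {s0 s1 s2 ℓ₀ ℓ : ℕ} (h0 : s0 < 3) (h1 : s1 < 3) (h2 : s2 < 3)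
    (hℓ₀ : ℓ₀ < Ψ.rs s0 s1 s2) (hℓ : ℓ < Ψ.rs s0 s1 s2) (hlt : ℓ₀ < ℓ) :
    Ψ.A s0 s1 s2 (Ψ.rowP s0 s1 s2 ℓ₀).1 (Ψ.rowP s0 s1 s2 ℓ₀).2.1 (Ψ.rowP s0 s1 s2 ℓ₀).2.2.1 (Ψ.rowP s0 s1 s2 ℓ₀).2.2.2 ℓ = 0 := by
  have hT : Ψ.validT = true := by
    rw [valid, Bool.and_eq_true, Bool.and_eq_true] at h
    exact h.1.2
  simp only [validT, Z8.allLT_iff, Bool.or_eq_true, Bool.and_eq_true, decide_eq_true_eq] at hT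
  rcases hT s0 h0 s1 h1 s2 h2 ℓ₀ hℓ₀ ℓ hℓ with hle | ⟨hA, -⟩
  · omega
  · exact hA

/-- soundness of (T), B part. -/
theorem B_lower_zero (h : Ψ.valid L1 L2 = true) {s0 s1 s2 ℓ₀ ℓ : ℕ} (h0 : s0 < 3) (h1 : s1 < 3) (h2 : s2 < 3)
    (hℓ₀ : ℓ₀ < Ψ.rs s0 s1 s2) (hℓ : ℓ < Ψ.rs s0 s1 s2) (hlt : ℓ₀ < ℓ) :
    Ψ.B s0 s1 s2 ℓ (Ψ.colP s0 s1 s2 ℓ₀).1 (Ψ.colP s0 s1 s2 ℓ₀).2.1 (Ψ.colP s0 s1 s2 ℓ₀).2.2 = 0 := by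
  have hT : Ψ.validT = true := by
    rw [valid, Bool.and_eq_true, Bool.and_eq_true] at h
    exact h.1.2
  simp only [validT, Z8.allLT_iff, Bool.or_eq_true, Bool.and_eq_true, decide_eq_true_eq] at hT
  rcases hT s0 h0 s1 h1 s2 h2 ℓ₀ hℓ₀ ℓ hℓ with hle | ⟨-, hB⟩
  · omega
  · exact hB

/-- soundness of (P). -/
theorem pivots (h : Ψ.valid L1 L2 = true) {s0 s1 s2 ℓ : ℕ} (h0 : s0 < 3) (h1 : s1 < 3) (h2 : s2 < 3) (hℓ : ℓ < Ψ.rs s0 s1 s2) :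
    (Ψ.A s0 s1 s2 (Ψ.rowP s0 s1 s2 ℓ).1 (Ψ.rowP s0 s1 s2 ℓ).2.1 (Ψ.rowP s0 s1 s2 ℓ).2.2.1 (Ψ.rowP s0 s1 s2 ℓ).2.2.2 ℓ).isPosConst = true ∧
    (Ψ.B s0 s1 s2 ℓ (Ψ.colP s0 s1 s2 ℓ).1 (Ψ.colP s0 s1 s2 ℓ).2.1 (Ψ.colP s0 s1 s2 ℓ).2.2 * Ψ.w s0 s1 s2 ℓ).isPosConst = true ∧
    ((Ψ.rowP s0 s1 s2 ℓ).1 ≤ 1 ∧ (Ψ.rowP s0 s1 s2 ℓ).2.1 ≤ s0 ∧ (Ψ.rowP s0 s1 s2 ℓ).2.2.1 ≤ s1 ∧ (Ψ.rowP s0 s1 s2 ℓ).2.2.2 ≤ s2 ∧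
      (Ψ.colP s0 s1 s2 ℓ).1 ≤ 2 - s0 ∧ (Ψ.colP s0 s1 s2 ℓ).2.1 ≤ 2 - s1 ∧ (Ψ.colP s0 s1 s2 ℓ).2.2 ≤ 2 - s2) := by
  have hP : Ψ.validP = true := by
    rw [valid, Bool.and_eq_true, Bool.and_eq_true] at h
    exact h.2
  simp only [validP, Z8.allLT_iff, Bool.and_eq_true, decide_eq_true_eq] at hP
  obtain ⟨⟨hA, hB⟩, hbox⟩ := hP s0 h0 s1 h1 s2 h2 ℓ hℓ
  exact ⟨hA, hB, hbox⟩

end StackCert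

/-- r_{shape k} of a stacked certificate for a type k of the fourfold … -/
abbrev srs4 (Ψ : StackCert) (k : Fin 6) : ℕ := Ψ.rs (PlaneRank.sig0 k) (PlaneRank.sig1 k) (PlaneRank.sig2 k)
/-- … of the sixfold … -/
abbrev srs6 (Ψ : StackCert) (k : Fin 19) : ℕ := Ψ.rs (PlaneRank6.sig0 k) (PlaneRank6.sig1 k) (PlaneRank6.sig2 k)
/-- … and of the eightfold. -/
abbrev srs8 (Ψ : StackCert) (k : Fin 45) : ℕ := Ψ.rs (PlaneRank8.sig0 k) (PlaneRank8.sig1 k) (PlaneRank8.sig2 k)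

end Summit.HodgeConjecture.HodgeConjecture.HodgeLocus.Census.PlaneSum
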